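import Summits.ValiantsHypothesis.ValiantsHypothesis.Theses.ValuativeGCT
import Literature.NumberTheory.DiophantineGeometry.SchurWeylPlethysmKroneckerBoundProofs
import Literature.Computability.AlgebraicComplexity.GCTObstructionsWeightForm
import Literature.Computability.AlgebraicComplexity.MultiplicityObstructionsProofs

/-!
Scratch (planner crux-plan, NOT the skeleton): candidate proofs of the two small stubs of
`Lines/hwtopoly-density-transport.lean`, to certify that they are TRUE AS TYPED (the card's cheapest
falsifier is the direction/sign of the character in the Borel clause).
-/

open MvPolynomial
open scoped BigOperators Matrix
open Literature.NumberTheory.DiophantineGeometry Literature.Computability.AlgebraicComplexity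

namespace StubProofsScratch

variable {σ : Type*} [Fintype σ] [LinearOrder σ]

omit [Fintype σ] [LinearOrder σ] in
/-- Evaluating a substitution: `eval x (aeval s P) = eval (eval x ∘ s) P`. -/
theorem eval_aeval_subst (s : σ × σ → MvPolynomial (σ × σ) ℂ) (x : σ × σ → ℂ)
    (P : MvPolynomial (σ × σ) ℂ) :
    eval x (aeval s P) = eval (fun i => eval x (s i)) P := by
  rw [aeval_eq_bind₁]
  show eval₂Hom (RingHom.id ℂ) x (bind₁ s P) = _
  rw [eval₂Hom_bind₁]
  rfl

theorem borelClause (f : MvPolynomial σ ℂ) (m : ℕ) (χ : Weight σ)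
    (x : ↥(highestWeightSpace (orbitCoordRep f m) χ))
    (g : GL σ ℂ) (hg : IsUpperTriangular g) :
    MvPolynomial.aeval (R := ℂ)
        (fun p : σ × σ => ∑ l : σ, ((g⁻¹ : GL σ ℂ) : Matrix σ σ ℂ) p.1 l • MvPolynomial.X (l, p.2))
        (hwToPoly f m χ x) = weightChar χ g • hwToPoly f m χ x := by
  obtain ⟨F, hF⟩ := Ideal.Quotient.mk_surjective (x : OrbitCoordRing f m)
  have hx : Ideal.Quotient.mk (orbitVanishingIdeal f m) F ∈ highestWeightSpace (orbitCoordRep f m) χ := by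
    rw [hF]; exact x.2
  rw [hwToPoly_apply, ← hF]
  apply MvPolynomial.eq_of_eval_eq_on_gl
  intro g'
  rw [eval_aeval_subst, smul_eval]
  have hpt : (fun i : σ × σ => eval (fun ij : σ × σ => (g' : Matrix σ σ ℂ) ij.1 ij.2)
      (∑ l : σ, ((g⁻¹ : GL σ ℂ) : Matrix σ σ ℂ) i.1 l • MvPolynomial.X (l, i.2))) =
      fun ij : σ × σ => (((g⁻¹ : GL σ ℂ) : Matrix σ σ ℂ) * (g' : Matrix σ σ ℂ)) ij.1 ij.2 := by
    funext ij
    simp [map_sum, smul_eval, eval_X, Matrix.mul_apply]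
  rw [hpt, eval_orbitCoordToPoly_mul_left f m hx ((borelSubgroup σ ℂ).inv_mem hg) g',
    weightChar_inv χ hg, inv_inv]

theorem stabClause (f : MvPolynomial σ ℂ) (m : ℕ) (F : MvPolynomial (DegIdx σ m) ℂ)
    (M : Matrix σ σ ℂ) (hM : linSubst σ ℂ M f = f) :
    MvPolynomial.aeval (R := ℂ) (fun p : σ × σ => ∑ l : σ, M l p.2 • MvPolynomial.X (p.1, l))
        (genericOrbitMap f m F) = genericOrbitMap f m F := by
  apply MvPolynomial.funext
  intro A
  rw [eval_aeval_subst]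
  set A' : Matrix σ σ ℂ := Matrix.of fun i j => A (i, j) with hA'
  have hA : (fun ij : σ × σ => A' ij.1 ij.2) = A := by
    funext ij; rw [hA', Matrix.of_apply]
  have hpt : (fun i : σ × σ => eval A (∑ l : σ, M l i.2 • MvPolynomial.X (i.1, l))) =
      fun ij : σ × σ => (A' * M) ij.1 ij.2 := by
    funext ij
    simp [map_sum, smul_eval, eval_X, Matrix.mul_apply, hA', mul_comm]
  rw [hpt, eval_genericOrbitMap, linSubst_mul, AlgHom.comp_apply, hM, ← eval_genericOrbitMap, hA]

/-- Products of powers of elements of `J` lie in `J ^ (sum of the exponents)`. -/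
theorem prod_pow_mem_pow_sum {R ι : Type*} [CommRing R] (t : Finset ι) (c : ι → R) (e : ι → ℕ)
    (J : Ideal R) (hc : ∀ i ∈ t, c i ∈ J) :
    ∏ i ∈ t, c i ^ e i ∈ J ^ (∑ i ∈ t, e i) := by
  classical
  induction t using Finset.induction_on with
  | empty => simp
  | insert a t ha ih =>
    rw [Finset.prod_insert ha, Finset.sum_insert ha, pow_add]
    exact Ideal.mul_mem_mul (Ideal.pow_mem_pow (hc a (Finset.mem_insert_self a t)) _)
      (ih fun i hi => hc i (Finset.mem_insert_of_mem hi))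

theorem powTransport (f : MvPolynomial σ ℂ) {m D : ℕ} (hm : m ≠ 0) (χ : Weight σ)
    (hχ : χ.size = -((m * D : ℕ) : ℤ))
    (x : ↥(highestWeightSpace (orbitCoordRep f m) χ))
    (J : Ideal (MvPolynomial (σ × σ) ℂ))
    (hJ : ∀ d : DegIdx σ m, genericOrbitMap f m (MvPolynomial.X d) ∈ J) :
    hwToPoly f m χ x ∈ J ^ D := by
  classical
  obtain ⟨F, hFD, hF⟩ := mem_orbitCoordRingDeg_iff.mp
    (mem_orbitCoordRingDeg_of_mem_highestWeightSpace f hm hχ x.2)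
  rw [hwToPoly_apply, ← hF, orbitCoordToPoly_mk]
  -- the generic coefficients
  set c : DegIdx σ m → MvPolynomial (σ × σ) ℂ := fun d => coeff d.1
    (linSubst σ (MvPolynomial (σ × σ) ℂ) (Matrix.mvPolynomialX σ σ ℂ)
      (map (C : ℂ →+* MvPolynomial (σ × σ) ℂ) f)) with hc
  have hgen : genericOrbitMap f m = aeval c := rfl
  have hcJ : ∀ d, c d ∈ J := fun d => by
    have h := hJ d
    rwa [hgen, aeval_X] at h
  rw [F.as_sum, map_sum]
  refine Ideal.sum_mem _ fun s hs => ?_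
  rw [hgen, aeval_monomial, Finsupp.prod]
  refine Ideal.mul_mem_left _ _ ?_
  rw [hFD.degree_eq_sum_deg_support hs]
  exact prod_pow_mem_pow_sum _ _ _ J fun d _ => hcJ d

/-! ## End-to-end certification: the line closes the crux modulo the support item stmt-12628 -/

theorem orbitMultiplicity_le_finrank_of_range_le {m : ℕ} {χ : Weight (MatIdx m)} {n : ℕ}
    {T : Submodule ℂ (MvPolynomial (MatIdx m × MatIdx m) ℂ)}
    (hT : T ≤ homogeneousSubmodule (MatIdx m × MatIdx m) ℂ n)
    (h : LinearMap.range (hwToPoly (detFormLex ℂ m) m χ) ≤ T) :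
    orbitMultiplicity ℂ (detFormLex ℂ m) m χ ≤ Module.finrank ℂ T := by
  haveI : Module.Finite ℂ (homogeneousSubmodule (MatIdx m × MatIdx m) ℂ n) :=
    finite_homogeneousSubmodule _ _ _
  haveI : Module.Finite ℂ T := Submodule.finiteDimensional_of_le hT
  calc orbitMultiplicity ℂ (detFormLex ℂ m) m χ
      = Module.finrank ℂ (highestWeightSpace (orbitCoordRep (detFormLex ℂ m) m) χ) := rfl
    _ = Module.finrank ℂ (LinearMap.range (hwToPoly (detFormLex ℂ m) m χ)) :=
        (LinearMap.finrank_range_of_inj (hwToPoly_injective _ _ _)).symm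
    _ ≤ Module.finrank ℂ T := Submodule.finrank_mono h

/-- CERTIFICATION (scratch, planner): with the three stub proofs above, the skeleton's composition is a
sorry-free proof of `CoeffVanishingOrder → ValuativeBound` (crux stmt-12625 modulo support item
stmt-12628). Same tactic script as `ValuativeBound_of` in the Lines file. -/
theorem valuativeBound_of_coeffVanishingOrder
    (hC : Summit.ValiantsHypothesis.ValiantsHypothesis.Theses.ValuativeGCT.CoeffVanishingOrder) :
    Summit.ValiantsHypothesis.ValiantsHypothesis.Theses.ValuativeGCT.ValuativeBound := by
  intro m _ U r hU δ lam hlam χ T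
  refine orbitMultiplicity_le_finrank_of_range_le (n := m * δ)
    (inf_le_left.trans (inf_le_left.trans inf_le_left)) ?_
  rintro _ ⟨x, rfl⟩
  obtain ⟨F, hF⟩ := Ideal.Quotient.mk_surjective (x : OrbitCoordRing (detFormLex ℂ m) m)
  have hx : Ideal.Quotient.mk (orbitVanishingIdeal (detFormLex ℂ m) m) F ∈
      highestWeightSpace (orbitCoordRep (detFormLex ℂ m) m) χ := by
    rw [hF]; exact x.2
  have hP : hwToPoly (detFormLex ℂ m) m χ x = genericOrbitMap (detFormLex ℂ m) m F := by
    rw [hwToPoly_apply, ← hF, orbitCoordToPoly_mk]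
  have hsize : χ.size = -((m * δ : ℕ) : ℤ) := size_toMatIdx_dualOfPartition m lam hlam
  have hdeg : (hwToPoly (detFormLex ℂ m) m χ x).IsHomogeneous (m * δ) := by
    rw [hwToPoly_apply, ← hF]
    exact isHomogeneous_orbitCoordToPoly _ _ hx hsize
  have hvan : hwToPoly (detFormLex ℂ m) m χ x ∈
      (MvPolynomial.vanishingIdeal ℂ
        {p : MatIdx m × MatIdx m → ℂ | ∀ j : MatIdx m, (fun i => p (j, i)) ∈ U}) ^ (δ * (m - r)) := by
    rw [mul_comm δ (m - r), pow_mul]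
    exact powTransport (detFormLex ℂ m) (NeZero.ne m) χ hsize x _ fun d => hC m U r hU d
  refine Submodule.mem_inf.mpr ⟨Submodule.mem_inf.mpr ⟨Submodule.mem_inf.mpr ⟨?_, ?_⟩, ?_⟩, ?_⟩
  · exact (mem_homogeneousSubmodule _ _).mpr hdeg
  · exact (Submodule.restrictScalars_mem ℂ _ _).mpr hvan
  · refine (Submodule.mem_iInf _).mpr fun M => (Submodule.mem_iInf _).mpr fun hM => ?_
    rw [LinearMap.mem_ker, LinearMap.sub_apply, LinearMap.id_apply, AlgHom.toLinearMap_apply,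
      sub_eq_zero, hP]
    exact stabClause (detFormLex ℂ m) m F M hM
  · refine (Submodule.mem_iInf _).mpr fun g => (Submodule.mem_iInf _).mpr fun hg => ?_
    rw [LinearMap.mem_ker, LinearMap.sub_apply, LinearMap.smul_apply, LinearMap.id_apply,
      AlgHom.toLinearMap_apply, sub_eq_zero]
    exact borelClause (detFormLex ℂ m) m χ x g hg

end StubProofsScratch
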